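import Mathlib
import Literature.AlgebraicGeometry.Resolution.AdicNoetherian
import Literature.AlgebraicGeometry.Resolution.PowerSeriesRegularLocal
import Literature.AlgebraicGeometry.Resolution.RegularLocalRingsUFD
import Summits.Langlands.Langlands.Theorems.PicardMuOrdinaryMuOrdinaryFamilyRTAccumulation
import Summits.Langlands.Langlands.Theorems.PicardMuOrdinaryMuOrdinaryFamilyRTEndgame
import HarnessLib

/-!
# Route `PicardMuOrdinary`, crux `MuOrdinaryFamilyRT` (stmt-Langlands-13757): stub 4 of the
# line `free-seed-smooth-rt` — accumulation of points over nearby weights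

This file proves STUB 4 (`stub_accumulate`) of the checked skeleton
`Cruxes/MuOrdinaryFamilyRT/Lines/free-seed-smooth-rt.lean` for the crux
`Summit.Langlands.Langlands.Theses.PicardMuOrdinary.MuOrdinaryFamilyRT` (item
`stmt-Langlands-13757`).  The statement `S.stub_accumulate` below is VERBATIM the registered
statement of the skeleton (declared in the skeleton's namespace
`Summit.Langlands.Langlands.Cruxes.MuOrdinaryFamilyRT.FreeSeedSmoothRt`).

**Statement.** `𝒪` a discrete valuation ring, module-finite over `ℤ₃`, embedded in `ℚ̄₃` by
a `ℤ₃`-compatible `j`; `T ≅ 𝒪⟦X₁,X₂,X₃⟧` as `𝒪`-algebras (`eT`); `Λ : 𝒪⟦T₁,T₂,T₃⟧ → T` a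
finite injective `𝒪`-algebra map; `x : T → ℚ̄₃` a point over `j`; `W` a set of ring maps
`𝒪⟦T₁,T₂,T₃⟧ → ℚ̄₃` accumulating UNIFORMLY at `x ∘ Λ`.  Then for every `M` some `κ ∈ W`
lifts to a point `y` of `T` (`y ∘ Λ = κ`) uniformly within `3^{-M}` of `x`.

**Proof.**
1. *The weight algebra `P = 𝒪⟦X₁,X₂,X₃⟧` is an integrally closed domain.*  It is a
   Noetherian local domain (tree: `isNoetherianRing_mvPowerSeries`) whose maximal ideal is
   generated by the four elements `ϖ, X₁, X₂, X₃` (tree: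
   `mem_span_range_X_of_constantCoeff_eq_zero`) and whose dimension is at least
   `dim k⟦X₁,X₂,X₃⟧ + 1 = 4` (reduction modulo `ϖ`, Mathlib
   `ringKrullDim_succ_le_of_surjective`, tree `ringKrullDim_mvPowerSeries`); so it is regular
   local, hence factorial (Auslander–Buchsbaum, tree
   `IsRegularLocalRing.uniqueFactorizationMonoid`), hence integrally closed.
2. *`T` is a domain*, being isomorphic to `P` through `eT` — the (only, but load-bearing) use
   of the regularity hypothesis `eT`: without it the statement is false
   (`Theorems/MuOrdinaryFamilyRT/Negative/AccumulateRegularity.lean`: a `Λ`-torsion component).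
3. *The weight `x ∘ Λ` of `x` is bounded by `1` on `P`.*  A ring map `y : 𝒪⟦X⟧ → ℚ̄₃` which is
   the standard embedding on `ℤ₃` has `‖y G‖ < 1` for every `G` without constant term:
   otherwise the minimal polynomial `μ` of `b = y G` over `ℚ₃` — whose coefficients are bounded
   by powers of `‖b‖`, the norm of `ℚ̄₃` being the spectral norm — divided by its constant
   coefficient lies in `ℤ₃[X]` and has constant term `1`, so `q(G)` is a unit of `𝒪⟦X⟧` mapping
   to `q(b) = 0`, absurd (`norm_lt_one_of_constantCoeff_eq_zero`).  Constants `j c` are integral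
   over `ℤ₃`, of norm `≤ 1` (`norm_le_one_of_isIntegral_padicInt` of the endgame file).
4. Hence the weights `κ ∈ W` within `3^{-M} ≤ 1` of `x ∘ Λ` are bounded by `1` as well
   (ultrametric inequality), and the *accumulation kernel* of the sister line
   `char-zero-dominance` (`CharZeroDominance.accumulation_domain`, tree file
   `PicardMuOrdinaryMuOrdinaryFamilyRTAccumulation`: normal base, domain finite torsion-free
   over it, bounded weights accumulating uniformly ⇒ points accumulating uniformly; separating
   element, root continuity, lying over + `IsAlgClosed.lift`) applies to `P → T`, `x` and
   `D = {κ ∈ W bounded by 1}`.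

References: Matsumura, *Commutative Ring Theory*, Thm 20.3 (Auslander–Buchsbaum), Thm 9.3
(lying over); Bosch–Güntzer–Remmert, *Non-Archimedean Analysis*, 3.2 (spectral norm on `ℚ̄ₚ`).
-/

-- `Summit.Langlands.Langlands.…` (summit = sub-problem name, D-0017 layout) trips `dupNamespace` on every decl.
set_option linter.dupNamespace false

namespace Summit.Langlands.Langlands.Cruxes.MuOrdinaryFamilyRT.FreeSeedSmoothRt

open Polynomial IsLocalRing IsUltrametricDist

/-! ## The registered statement (verbatim) -/

/-- STUB 4 (ACCUMULATION OF POINTS OVER NEARBY WEIGHTS; commutative algebra / non-archimedean analysis,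
provable now).  `𝒪 = 𝒪_E` (`E/ℚ₃` finite) embedded in `ℚ̄₃` by `j`, `T ≅ 𝒪⟦X,Y,Z⟧` as `𝒪`-algebras,
`Λ : 𝒪⟦T₁,T₂,T₃⟧ → T` finite injective, `x` a `ℚ̄₃`-point of `T` over `j`, `W` any set of
`ℚ̄₃`-points of `Λ` accumulating (uniformly) at `x ∘ Λ`: then for every `M` some `κ ∈ W` lifts to a
point `y` of `T` uniformly within `3^{-M}` of `x`.  Why true: points of `𝒪⟦X,Y,Z⟧` over `j` are
automatically bounded (`|y(X)| < 1`); `T` regular and finite over the regular `Λ` is finite FREE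
(Auslander–Buchsbaum), so `Spf T → Spf Λ` is finite flat, hence open on rigid generic fibres and
surjective near `x`; root continuity + a separating element give one `y` close to `x` on all of `T`
(ultrametric bookkeeping); small `M` follow from large `M`.  FALSE without regularity of `T`/`Λ`
(two analytic branches), whence the hypothesis `eT`.  Size L.  Leans on: Mathlib `MvPowerSeries`,
`PadicAlgCl` (norm), `RingHom.Finite`; tree `exists_root_near_of_norm_eval_le`-type root continuity. -/
def S.stub_accumulate : Prop :=
  ∀ (𝒪 : Type) [CommRing 𝒪] [IsDomain 𝒪] [IsDiscreteValuationRing 𝒪] [Algebra ℤ_[3] 𝒪]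
    [Module.Finite ℤ_[3] 𝒪] (j : 𝒪 →+* PadicAlgCl 3), Function.Injective j →
    j.comp (algebraMap ℤ_[3] 𝒪) = algebraMap ℤ_[3] (PadicAlgCl 3) →
    ∀ (T : Type) [CommRing T] [Algebra 𝒪 T] (eT : MvPowerSeries (Fin 3) 𝒪 ≃ₐ[𝒪] T)
      (Λ : MvPowerSeries (Fin 3) 𝒪 →ₐ[𝒪] T), Function.Injective Λ → Λ.toRingHom.Finite →
    ∀ (x : T →+* PadicAlgCl 3), x.comp (algebraMap 𝒪 T) = j →
    ∀ (W : Set (MvPowerSeries (Fin 3) 𝒪 →+* PadicAlgCl 3)),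
      (∀ M : ℕ, ∃ κ ∈ W, ∀ a, ‖κ a - x (Λ a)‖ ≤ ((3 : ℝ)⁻¹) ^ M) →
    ∀ M : ℕ, ∃ κ ∈ W, ∃ y : T →+* PadicAlgCl 3,
      y.comp Λ.toRingHom = κ ∧ ∀ t, ‖y t - x t‖ ≤ ((3 : ℝ)⁻¹) ^ M

/-! ## Points of `𝒪⟦X⟧` standard on `ℤ₃` are bounded -/

/-- Coefficient bound for the minimal polynomial over `ℚ₃` of an element `b ∈ ℚ̄₃`:
`‖μ_n‖ ≤ ‖b‖ ^ (deg μ - n)` (the norm of `ℚ̄₃` is the spectral norm). -/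
theorem norm_coeff_minpoly_le (b : PadicAlgCl 3) {n : ℕ}
    (hn : n < (minpoly ℚ_[3] b).natDegree) :
    ‖(minpoly ℚ_[3] b).coeff n‖ ≤ ‖b‖ ^ ((minpoly ℚ_[3] b).natDegree - n) := by
  set μ := minpoly ℚ_[3] b
  have h1 : spectralValueTerms μ n ≤ spectralValue μ :=
    le_ciSup (spectralValueTerms_bddAbove μ) n
  rw [spectralValueTerms_of_lt_natDegree μ hn] at h1
  have h2 : spectralValue μ = ‖b‖ := PadicAlgCl.spectralNorm_eq 3 b
  rw [h2] at h1
  have hpos : (0 : ℝ) < (μ.natDegree - n : ℝ) := by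
    rw [sub_pos]; exact_mod_cast hn
  have h3 := Real.rpow_le_rpow (by positivity) h1 hpos.le
  rw [← Real.rpow_mul (norm_nonneg _), one_div_mul_cancel hpos.ne', Real.rpow_one] at h3
  have h4 : (μ.natDegree - n : ℝ) = ((μ.natDegree - n : ℕ) : ℝ) := by
    rw [Nat.cast_sub hn.le]
  rwa [h4, Real.rpow_natCast] at h3

/-- **Boundedness of points of `𝒪⟦X⟧`, I.**  For a ring map `y : 𝒪⟦Xᵢ : i ∈ σ⟧ → ℚ̄₃` which is the
standard embedding on `ℤ₃` and a power series `G` without constant term, `‖y G‖ < 1`: otherwise the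
minimal polynomial `μ` of `b = y G` over `ℚ₃`, divided by its constant coefficient, has coefficients
in `ℤ₃` and constant term `1`, so `q(G)` is a unit of `𝒪⟦X⟧` mapping to `q(b) = 0`. -/
theorem norm_lt_one_of_constantCoeff_eq_zero {σ : Type*} {𝒪 : Type*} [CommRing 𝒪]
    [Algebra ℤ_[3] 𝒪] (y : MvPowerSeries σ 𝒪 →+* PadicAlgCl 3)
    (hy : y.comp (algebraMap ℤ_[3] (MvPowerSeries σ 𝒪)) = algebraMap ℤ_[3] (PadicAlgCl 3))
    {G : MvPowerSeries σ 𝒪} (hG : MvPowerSeries.constantCoeff G = 0) : ‖y G‖ < 1 := by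
  set b := y G with hb_def
  by_contra hb
  rw [not_lt] at hb
  have hb0 : b ≠ 0 := by
    rintro h; rw [h, norm_zero] at hb; exact not_lt.mpr hb one_pos
  have hint : IsIntegral ℚ_[3] b := (Algebra.IsAlgebraic.isAlgebraic b).isIntegral
  set μ := minpoly ℚ_[3] b with hμ_def
  set d := μ.natDegree with hd_def
  have hd : 0 < d := minpoly.natDegree_pos hint
  have hμ0 : μ.coeff 0 ≠ 0 := minpoly.coeff_zero_ne_zero hint hb0
  -- `‖μ₀‖ = ‖b‖ ^ d`
  have hc0 : ‖μ.coeff 0‖ = ‖b‖ ^ d := by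
    have h := spectralNorm.spectralNorm_eq_norm_coeff_zero_rpow ℚ_[3] (PadicAlgCl 3) b
    rw [PadicAlgCl.spectralNorm_eq 3] at h
    have hdpos : (0 : ℝ) < (d : ℝ) := by exact_mod_cast hd
    have h' : ‖b‖ ^ (d : ℝ) = (‖μ.coeff 0‖ ^ (1 / (d : ℝ))) ^ (d : ℝ) := by rw [← h]
    rw [← Real.rpow_mul (norm_nonneg _), one_div_mul_cancel hdpos.ne', Real.rpow_one,
      Real.rpow_natCast] at h'
    exact h'.symm
  -- all coefficients of `μ` are bounded by `‖μ₀‖`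
  have hcoeff : ∀ n, ‖μ.coeff n‖ ≤ ‖μ.coeff 0‖ := by
    intro n
    rcases lt_trichotomy n d with hn | hn | hn
    · calc ‖μ.coeff n‖ ≤ ‖b‖ ^ (d - n) := norm_coeff_minpoly_le b hn
        _ ≤ ‖b‖ ^ d := pow_le_pow_right₀ hb (Nat.sub_le d n)
        _ = ‖μ.coeff 0‖ := hc0.symm
    · have : μ.coeff n = 1 := by rw [hn]; exact (minpoly.monic hint).coeff_natDegree
      rw [this, norm_one, hc0]
      exact one_le_pow₀ hb
    · rw [coeff_eq_zero_of_natDegree_lt hn, norm_zero]; exact norm_nonneg _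
  -- `q = μ / μ₀` has coefficients of norm `≤ 1`, hence lifts to `ℤ₃[X]`
  set q : ℚ_[3][X] := μ * C (μ.coeff 0)⁻¹ with hq_def
  have hqc : ∀ n, q.coeff n = μ.coeff n * (μ.coeff 0)⁻¹ := fun n => by rw [hq_def, coeff_mul_C]
  have hq1 : ∀ n, ‖q.coeff n‖ ≤ 1 := by
    intro n
    rw [hqc, norm_mul, norm_inv]
    have hpos : 0 < ‖μ.coeff 0‖ := norm_pos_iff.mpr hμ0
    rw [mul_inv_le_iff₀ hpos, one_mul]
    exact hcoeff n
  obtain ⟨q', hq'⟩ : ∃ q' : ℤ_[3][X], q'.map (algebraMap ℤ_[3] ℚ_[3]) = q := by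
    rw [← mem_lifts, lifts_iff_coeff_lifts]
    intro n
    exact ⟨⟨q.coeff n, hq1 n⟩, rfl⟩
  have hq'0 : q'.coeff 0 = 1 := by
    have h := congrArg (fun p : ℚ_[3][X] => p.coeff 0) hq'
    simp only [coeff_map] at h
    rw [hqc, mul_inv_cancel₀ hμ0] at h
    exact IsFractionRing.injective ℤ_[3] ℚ_[3] (by rw [h, map_one])
  -- `Q = q'(G)` is a unit of `𝒪⟦X⟧` ...
  set Q : MvPowerSeries σ 𝒪 := q'.eval₂ (algebraMap ℤ_[3] (MvPowerSeries σ 𝒪)) G with hQ_def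
  have hQunit : IsUnit Q := by
    rw [MvPowerSeries.isUnit_iff_constantCoeff, hQ_def, hom_eval₂, hG, eval₂_at_zero, hq'0,
      map_one]
    exact isUnit_one
  -- ... mapping to `q(b) = 0`
  have hyQ : y Q = 0 := by
    rw [hQ_def, hom_eval₂, hy, IsScalarTower.algebraMap_eq ℤ_[3] ℚ_[3] (PadicAlgCl 3),
      ← eval₂_map, hq', hq_def, eval₂_mul, eval₂_C]
    have : μ.eval₂ (algebraMap ℚ_[3] (PadicAlgCl 3)) b = 0 := minpoly.aeval ℚ_[3] b
    rw [this, zero_mul]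
  exact (hQunit.map y).ne_zero hyQ

/-- For a `ℤ₃`-compatible ring map `j : 𝒪 → ℚ̄₃` on a module-finite `ℤ₃`-algebra, `‖j c‖ ≤ 1`
(elements of `ℚ̄₃` integral over `ℤ₃` lie in the closed unit ball:
`norm_le_one_of_isIntegral_padicInt` of the endgame file). -/
theorem norm_map_le_one {𝒪 : Type*} [CommRing 𝒪] [Algebra ℤ_[3] 𝒪] [Module.Finite ℤ_[3] 𝒪]
    (j : 𝒪 →+* PadicAlgCl 3)
    (hj : j.comp (algebraMap ℤ_[3] 𝒪) = algebraMap ℤ_[3] (PadicAlgCl 3)) (c : 𝒪) :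
    ‖j c‖ ≤ 1 := by
  obtain ⟨p, hp, hpc⟩ : IsIntegral ℤ_[3] c := Algebra.IsIntegral.isIntegral c
  refine norm_le_one_of_isIntegral_padicInt ⟨p, hp, ?_⟩
  rw [← hj, ← hom_eval₂, hpc, map_zero]

/-- **Boundedness of points of `𝒪⟦X⟧`, II.**  A ring map `y : 𝒪⟦Xᵢ : i ∈ σ⟧ → ℚ̄₃` standard on
`ℤ₃` and bounded by `1` on constants is bounded by `1` everywhere. -/
theorem norm_apply_le_one {σ : Type*} {𝒪 : Type*} [CommRing 𝒪] [Algebra ℤ_[3] 𝒪]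
    (y : MvPowerSeries σ 𝒪 →+* PadicAlgCl 3)
    (hy : y.comp (algebraMap ℤ_[3] (MvPowerSeries σ 𝒪)) = algebraMap ℤ_[3] (PadicAlgCl 3))
    (hyC : ∀ c, ‖y (MvPowerSeries.C c)‖ ≤ 1) (F : MvPowerSeries σ 𝒪) : ‖y F‖ ≤ 1 := by
  have hF : F = MvPowerSeries.C (MvPowerSeries.constantCoeff F) +
      (F - MvPowerSeries.C (MvPowerSeries.constantCoeff F)) := by ring
  rw [hF, map_add]
  refine (norm_add_le_max _ _).trans (max_le (hyC _) ?_)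
  exact (norm_lt_one_of_constantCoeff_eq_zero y hy (by simp)).le

/-! ## `𝒪⟦X₁, X₂, X₃⟧` is a regular local ring, hence integrally closed -/

section WeightAlgebra

variable (𝒪 : Type*) [CommRing 𝒪] [IsDomain 𝒪] [IsDiscreteValuationRing 𝒪]

/-- The maximal ideal of `𝒪⟦X₁, X₂, X₃⟧` (`𝒪` a discrete valuation ring with uniformizer `ϖ`)
is generated by `ϖ, X₁, X₂, X₃`. -/
theorem maximalIdeal_mvPowerSeries_eq {ϖ : 𝒪} (hϖ : Irreducible ϖ) :
    maximalIdeal (MvPowerSeries (Fin 3) 𝒪) =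
      Ideal.span (insert (MvPowerSeries.C ϖ) (Set.range MvPowerSeries.X)) := by
  apply le_antisymm
  · intro F hF
    rw [mem_maximalIdeal, mem_nonunits_iff, MvPowerSeries.isUnit_iff_constantCoeff] at hF
    have h0 : MvPowerSeries.constantCoeff F ∈ maximalIdeal 𝒪 := hF
    rw [hϖ.maximalIdeal_eq, Ideal.mem_span_singleton'] at h0
    obtain ⟨a, ha⟩ := h0
    have hF' : F = MvPowerSeries.C a * MvPowerSeries.C ϖ +
        (F - MvPowerSeries.C (MvPowerSeries.constantCoeff F)) := by
      rw [← map_mul, ha]; ring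
    rw [hF']
    refine Ideal.add_mem _ (Ideal.mul_mem_left _ _ (Ideal.subset_span (Set.mem_insert _ _))) ?_
    refine Ideal.span_mono (Set.subset_insert _ _) ?_
    apply Literature.AlgebraicGeometry.Resolution.MvPowerSeries.mem_span_range_X_of_constantCoeff_eq_zero
    simp
  · rw [Ideal.span_le]
    rintro G (rfl | ⟨i, rfl⟩)
    · rw [SetLike.mem_coe, mem_maximalIdeal, mem_nonunits_iff,
        MvPowerSeries.isUnit_iff_constantCoeff, MvPowerSeries.constantCoeff_C]
      exact hϖ.not_isUnit
    · rw [SetLike.mem_coe, mem_maximalIdeal, mem_nonunits_iff,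
        MvPowerSeries.isUnit_iff_constantCoeff, MvPowerSeries.constantCoeff_X]
      exact not_isUnit_zero

/-- `dim 𝒪⟦X₁, X₂, X₃⟧ ≥ 4`: reduction modulo `ϖ` onto `k⟦X₁, X₂, X₃⟧`, of dimension `3`. -/
theorem four_le_ringKrullDim_mvPowerSeries :
    (4 : WithBot ℕ∞) ≤ ringKrullDim (MvPowerSeries (Fin 3) 𝒪) := by
  obtain ⟨ϖ, hϖ⟩ := IsDiscreteValuationRing.exists_irreducible 𝒪
  let f : MvPowerSeries (Fin 3) 𝒪 →+* MvPowerSeries (Fin 3) (ResidueField 𝒪) :=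
    MvPowerSeries.map (residue 𝒪)
  have hf : Function.Surjective f := fun g => by
    refine ⟨fun e => Function.surjInv residue_surjective (MvPowerSeries.coeff e g), ?_⟩
    ext e
    rw [MvPowerSeries.coeff_map]
    exact Function.surjInv_eq residue_surjective _
  have hϖ0 : (MvPowerSeries.C ϖ : MvPowerSeries (Fin 3) 𝒪) ∈ nonZeroDivisors _ := by
    refine mem_nonZeroDivisors_of_ne_zero fun h => hϖ.ne_zero ?_
    have := congrArg MvPowerSeries.constantCoeff h
    rwa [MvPowerSeries.constantCoeff_C, map_zero] at this
  have hfϖ : f (MvPowerSeries.C ϖ) = 0 := by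
    rw [MvPowerSeries.map_C, (residue_eq_zero_iff ϖ).mpr hϖ.not_isUnit, map_zero]
  have h := ringKrullDim_succ_le_of_surjective f hf hϖ0 hfϖ
  rw [Literature.AlgebraicGeometry.Resolution.ringKrullDim_mvPowerSeries (ResidueField 𝒪) (Fin 3),
    Nat.card_eq_fintype_card, Fintype.card_fin] at h
  exact le_trans (by norm_num) h

/-- **`𝒪⟦X₁, X₂, X₃⟧` is a regular local ring** for a discrete valuation ring `𝒪`: it is
Noetherian local of dimension `≥ 4` with maximal ideal generated by the `4` elements
`ϖ, X₁, X₂, X₃`. -/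
theorem isRegularLocalRing_mvPowerSeries : IsRegularLocalRing (MvPowerSeries (Fin 3) 𝒪) := by
  haveI : IsNoetherianRing (MvPowerSeries (Fin 3) 𝒪) :=
    Literature.AlgebraicGeometry.Resolution.isNoetherianRing_mvPowerSeries 𝒪 (Fin 3)
  obtain ⟨ϖ, hϖ⟩ := IsDiscreteValuationRing.exists_irreducible 𝒪
  refine IsRegularLocalRing.of_spanFinrank_maximalIdeal_le _ (le_trans ?_
    (four_le_ringKrullDim_mvPowerSeries 𝒪))
  have hfin : (insert (MvPowerSeries.C ϖ) (Set.range MvPowerSeries.X) :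
      Set (MvPowerSeries (Fin 3) 𝒪)).Finite := (Set.finite_range _).insert _
  have h1 := Submodule.spanFinrank_span_le_ncard_of_finite (R := MvPowerSeries (Fin 3) 𝒪) hfin
  have h1' : (maximalIdeal (MvPowerSeries (Fin 3) 𝒪)).spanFinrank ≤ (insert (MvPowerSeries.C ϖ)
      (Set.range MvPowerSeries.X) : Set (MvPowerSeries (Fin 3) 𝒪)).ncard := by
    rw [maximalIdeal_mvPowerSeries_eq 𝒪 hϖ]; exact h1
  have h2 : (insert (MvPowerSeries.C ϖ) (Set.range MvPowerSeries.X) :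
      Set (MvPowerSeries (Fin 3) 𝒪)).ncard ≤ 4 := by
    refine (Set.ncard_insert_le _ _).trans ?_
    have : (Set.range (MvPowerSeries.X : Fin 3 → MvPowerSeries (Fin 3) 𝒪)).ncard ≤ 3 := by
      rw [← Set.image_univ]
      simpa using Set.ncard_image_le (f := (MvPowerSeries.X : Fin 3 → MvPowerSeries (Fin 3) 𝒪))
        (s := Set.univ) Set.finite_univ
    omega
  exact_mod_cast h1'.trans h2

/-- **`𝒪⟦X₁, X₂, X₃⟧` is integrally closed** (regular local rings are factorial:
Auslander–Buchsbaum, Matsumura Thm. 20.3, from the tree; factorial domains are integrally closed). -/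
theorem isIntegrallyClosed_mvPowerSeries : IsIntegrallyClosed (MvPowerSeries (Fin 3) 𝒪) := by
  haveI := isRegularLocalRing_mvPowerSeries 𝒪
  haveI : UniqueFactorizationMonoid (MvPowerSeries (Fin 3) 𝒪) :=
    Literature.AlgebraicGeometry.Resolution.IsRegularLocalRing.uniqueFactorizationMonoid _
  infer_instance

end WeightAlgebra

/-! ## The registered stub -/

/-- **STUB 4 of the line `free-seed-smooth-rt` (`stub_accumulate`, registered signature verbatim):
accumulation of points over nearby weights.**  `P = 𝒪⟦X₁,X₂,X₃⟧` is an integrally closed domain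
(`isIntegrallyClosed_mvPowerSeries`), `T ≅ P` is a domain, finite and torsion-free over `P` through
`Λ`, the weight `x ∘ Λ` is bounded by `1` (`norm_apply_le_one`), so are the weights of `W` close to
it, and the accumulation kernel `CharZeroDominance.accumulation_domain` of the sister line yields the
point `y`. -/
theorem stub_accumulate : S.stub_accumulate := by
  intro 𝒪 _ _ _ _ _ j _hjinj hj T _ _ eT Λ hΛinj hΛfin x hx W hW M
  -- the rings: `P` normal domain, `T ≅ P` a domain, finite and torsion-free over `P` via `Λ`
  haveI : IsDomain (MvPowerSeries (Fin 3) 𝒪) := NoZeroDivisors.to_isDomain _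
  haveI : IsIntegrallyClosed (MvPowerSeries (Fin 3) 𝒪) := isIntegrallyClosed_mvPowerSeries 𝒪
  haveI : IsDomain T :=
    MulEquiv.isDomain (MvPowerSeries (Fin 3) 𝒪) eT.symm.toRingEquiv.toMulEquiv
  letI : Algebra (MvPowerSeries (Fin 3) 𝒪) T := Λ.toRingHom.toAlgebra
  haveI : Module.Finite (MvPowerSeries (Fin 3) 𝒪) T := hΛfin
  haveI : Module.IsTorsionFree (MvPowerSeries (Fin 3) 𝒪) T :=
    Module.isTorsionFree_iff_algebraMap_injective.mpr hΛinj
  -- compatibilities with the structure maps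
  have hΛC : ∀ c : 𝒪, Λ (MvPowerSeries.C c) = algebraMap 𝒪 T c := fun c => Λ.commutes c
  have hxC : ∀ c : 𝒪, x (algebraMap 𝒪 T c) = j c := fun c => by
    rw [← hx]; rfl
  have hjstd : ∀ z : ℤ_[3], j (algebraMap ℤ_[3] 𝒪 z) = algebraMap ℤ_[3] (PadicAlgCl 3) z :=
    fun z => by rw [← hj]; rfl
  have hstdP : ∀ z : ℤ_[3], algebraMap ℤ_[3] (MvPowerSeries (Fin 3) 𝒪) z =
      MvPowerSeries.C (algebraMap ℤ_[3] 𝒪 z) := fun z => MvPowerSeries.algebraMap_apply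
  -- the weight `x ∘ Λ` of `x` is bounded by `1`
  let x' : MvPowerSeries (Fin 3) 𝒪 →+* PadicAlgCl 3 := x.comp Λ.toRingHom
  have hx'a : ∀ F, x' F = x (Λ F) := fun F => rfl
  have hx'std : x'.comp (algebraMap ℤ_[3] (MvPowerSeries (Fin 3) 𝒪)) =
      algebraMap ℤ_[3] (PadicAlgCl 3) := by
    ext z
    rw [RingHom.comp_apply, hx'a, hstdP, hΛC, hxC, hjstd]
  have hx'C : ∀ c, ‖x' (MvPowerSeries.C c)‖ ≤ 1 := fun c => by
    rw [hx'a, hΛC, hxC]; exact norm_map_le_one j hj c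
  have hxΛ : ∀ a, ‖x (algebraMap (MvPowerSeries (Fin 3) 𝒪) T a)‖ ≤ 1 :=
    norm_apply_le_one x' hx'std hx'C
  -- the bounded weights of `W` still accumulate at `x ∘ Λ`
  let D : Set (MvPowerSeries (Fin 3) 𝒪 →+* PadicAlgCl 3) := {κ | κ ∈ W ∧ ∀ a, ‖κ a‖ ≤ 1}
  have hD : ∀ κ ∈ D, ∀ a, ‖κ a‖ ≤ 1 := fun κ hκ => hκ.2
  have hacc : ∀ N : ℕ, ∃ κ ∈ D, ∀ a, ‖κ a - x (algebraMap (MvPowerSeries (Fin 3) 𝒪) T a)‖ ≤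
      ((3 : ℝ)⁻¹) ^ N := fun N => by
    obtain ⟨κ, hκW, hκ⟩ := hW N
    refine ⟨κ, ⟨hκW, fun a => ?_⟩, hκ⟩
    have ha : κ a = (κ a - x (Λ a)) + x (Λ a) := by ring
    rw [ha]
    exact (norm_add_le_max _ _).trans (max_le ((hκ a).trans (pow_le_one₀ (by norm_num)
      (by norm_num))) (hxΛ a))
  -- the accumulation kernel of the sister line `char-zero-dominance`
  obtain ⟨y, hyD, hy⟩ := CharZeroDominance.accumulation_domain (MvPowerSeries (Fin 3) 𝒪) T x D
    hxΛ hD hacc M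
  exact ⟨y.comp Λ.toRingHom, hyD.1, y, rfl, hy⟩

end Summit.Langlands.Langlands.Cruxes.MuOrdinaryFamilyRT.FreeSeedSmoothRt
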